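import Literature.NumberTheory.Automorphic.AdelicAdditiveCharacter
import Literature.NumberTheory.GaloisRepresentations.PadicAlgebraOfLocalField
import Mathlib.NumberTheory.Cyclotomic.CyclotomicCharacter
import Mathlib.RingTheory.RootsOfUnity.AlgebraicallyClosed
import Mathlib.Topology.Algebra.Valued.WithZeroMulInt
import HarnessLib

/-!
# The Galois twist of the local standard additive character: `σ ∘ ψ_v = ψ_v(κ_σ ·)`, `κ_σ = χ_cyc(σ)`

Topic `Literature/NumberTheory/Automorphic`, namespace `Literature.NumberTheory.Automorphic`.
Theorems only (no definition, no named fact, no instance).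

Let `K` be a number field, `v` a finite place of residue characteristic `ℓ` (`(ℓ : 𝓞 K) ∈ v`), and
`ψ_v = adeleAddCharAt K v` the local component of the standard additive character of `𝔸_K`
(`Automorphic/AdelicAdditiveCharacter`; trivial on `𝒪_v`, `adeleAddCharAt_eq_one_of_mem`).  For an
ARBITRARY ring automorphism `σ` of `ℂ` (no continuity) we prove

  `σ (ψ_v(r)) = ψ_v(κ_σ · r)` for all `r ∈ K_v`, with `κ_σ := χ_ℓ(σ) ∈ ℤ_ℓ^× ⊂ 𝒪_v^×`

the `ℓ`-adic cyclotomic character of `σ` (Mathlib `cyclotomicCharacter ℂ ℓ`), read in `K_v` through the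
canonical `ℚ_ℓ`-algebra structure of `K_v` (tree `LocalField.adicCompletionPadicAlgebra`).  This is the
arithmetic input «`σ ∘ ψ_v = ψ_v(κ_p ·)`, `κ_p = χ_{cyc,p}(σ)`» of the `Aut(ℂ)`-twist calculus of the local
Schrödinger / Weil representation (cell `hodgecm-mathlib`, row III-11 road, pieces P3a/P4: the `σ`-twist of the
`ψ_v`-Schrödinger model of a hermitian line `⟨a⟩` is the `ψ_v`-model of `⟨κ_σ a⟩`).

PROOF.  `ψ_v` is trivial on `𝒪_v` and `ℓⁿ r ∈ 𝒪_v` for `n ≫ 0` (`|ℓ|_v < 1`), so `ψ_v(r)` is an `ℓⁿ`-th root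
of unity; `σ` raises `ℓⁿ`-th roots of unity to the power `a ≡ χ_ℓ(σ) (mod ℓⁿ)` (`cyclotomicCharacter.spec`);
and `ψ_v(χ_ℓ(σ) r) = ψ_v(a r + z ℓⁿ r) = ψ_v(a r) = ψ_v(r)^a` since `z ℓⁿ r ∈ 𝒪_v` for `z ∈ ℤ_ℓ`.

## Main statements

* `exists_pow_natCast_mul_mem_adicCompletionIntegers` — `ℓⁿ r ∈ 𝒪_v` for some `n`.
* `adeleAddCharAt_pow_prime_pow_eq_one` — `ψ_v(r)^{ℓⁿ} = 1` once `ℓⁿ r ∈ 𝒪_v`.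
* `ringEquiv_adeleAddCharAt_eq_cyclotomicCharacter_mul` — THE FORMULA with `κ_σ = χ_ℓ(σ)` explicit.
* `exists_ringEquiv_adeleAddCharAt_eq_mul` — packaged: `∃ κ, |κ|_v = 1 ∧ ∀ r, σ (ψ_v r) = ψ_v (κ r)`
  (`= (ψ_v.mulShift κ) r`, `exists_ringEquiv_adeleAddCharAt_eq_mulShift`); `exists_ringHom_adeleAddCharAt_eq_mul` —
  the same in the `(τ, τ′) = (σ, σ⁻¹) : ℂ →+* ℂ` currency of `HeisenbergGroup/SchrodingerGaloisTwist` (with the two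
  inverse identities), the `hκ`/`hττ'`/`hτ'τ` inputs of `LocalMp.galTwist`.

## References

* J. Tate, *Fourier analysis in number fields and Hecke's zeta-functions* (thesis, 1950), §2.2 (the local
  characters `ψ_𝔭`, trivial exactly on the inverse different ⊇ `𝒪_𝔭`, values `ℓ`-power roots of unity).
* J.-P. Serre, *Local Fields* (GTM 67), Ch. II §5 (`ℚ_ℓ ⊂ K_v`); the cyclotomic character: J. Neukirch,
  A. Schmidt, K. Wingberg, *Cohomology of Number Fields*, (7.3.6)–(7.3.7).
-/

noncomputable section

open IsDedekindDomain NumberField Filter Topology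
open scoped NumberField ValuativeRel

namespace Literature.NumberTheory.Automorphic

open Literature.NumberTheory.GaloisRepresentations

variable (K : Type) [Field K] [NumberField K] (v : HeightOneSpectrum (𝓞 K))

/-! ## §1. `ℓⁿ r ∈ 𝒪_v` for `n ≫ 0`, and `ψ_v(r)` is an `ℓ`-power root of unity -/

/-- `|ℓ|_v < 1` in `K_v` when `v ∣ ℓ`, in the `Valued.v` currency of `adicCompletion` (the tree's
`LocalField.valuation_adicCompletion_natCast_lt_one` transported along the compatibility of `Valued.v` with the
valuative relation of `K_v`); Serre, *Local Fields* Ch. II §5 (`ℚ_ℓ ⊂ K`, `|ℓ| < 1`). [cite: SerreLocalFields1979, Ch. II §5] -/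
theorem valued_natCast_lt_one_of_mem {ℓ : ℕ} (hv : ((ℓ : ℕ) : 𝓞 K) ∈ v.asIdeal) :
    Valued.v (ℓ : v.adicCompletion K) < 1 :=
  (Valued.v (R := v.adicCompletion K)).vlt_one_iff.mp
    ((ValuativeRel.valuation (v.adicCompletion K)).vlt_one_iff.mpr
      (LocalField.valuation_adicCompletion_natCast_lt_one v ℓ hv))

/-- **`ℓⁿ r ∈ 𝒪_v` for some `n`** (`v ∣ ℓ`): `ℓⁿ r → 0` in `K_v` since `|ℓ|_v < 1`, and `𝒪_v` is a
neighbourhood of `0` (Tate's thesis §2.2: `k_𝔭 = ⋃ₙ 𝔭⁻ⁿ𝒪_𝔭`). [cite: CasselsFrohlichANT1967, Ch. XV (Tate), §2.2] -/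
theorem exists_pow_natCast_mul_mem_adicCompletionIntegers {ℓ : ℕ} (hv : ((ℓ : ℕ) : 𝓞 K) ∈ v.asIdeal)
    (r : v.adicCompletion K) :
    ∃ n : ℕ, (ℓ : v.adicCompletion K) ^ n * r ∈ v.adicCompletionIntegers K := by
  have ht : Tendsto (fun n : ℕ => (ℓ : v.adicCompletion K) ^ n * r) atTop (𝓝 0) := by
    simpa only [zero_mul] using
      (Valued.tendsto_zero_pow_of_v_lt_one (valued_natCast_lt_one_of_mem K v hv)).mul_const r
  have hO : ((v.adicCompletionIntegers K : Set (v.adicCompletion K))) ∈ 𝓝 (0 : v.adicCompletion K) :=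
    (Valued.isOpen_valuationSubring (v.adicCompletion K)).mem_nhds (zero_mem _)
  exact (ht.eventually_mem hO).exists

/-- `ψ_v(a · r) = ψ_v(r)^a` for `a ∈ ℕ` (`ψ_v` is an additive character, Tate's thesis §2.2). [cite: CasselsFrohlichANT1967, Ch. XV (Tate), §2.2] -/
theorem adeleAddCharAt_natCast_mul (a : ℕ) (r : v.adicCompletion K) :
    adeleAddCharAt K v ((a : v.adicCompletion K) * r) = adeleAddCharAt K v r ^ a := by
  rw [← nsmul_eq_mul, AddChar.map_nsmul_eq_pow]

/-- **`ψ_v(r)` is an `ℓⁿ`-th root of unity as soon as `ℓⁿ r ∈ 𝒪_v`** (`ψ_v` is trivial on `𝒪_v`; Tate's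
thesis §2.2: the values of `ψ_𝔭` are `p`-power roots of unity). [cite: Tate1950, §2.2] -/
theorem adeleAddCharAt_pow_prime_pow_eq_one {ℓ n : ℕ} {r : v.adicCompletion K}
    (hr : (ℓ : v.adicCompletion K) ^ n * r ∈ v.adicCompletionIntegers K) :
    (adeleAddCharAt K v r : ℂ) ^ (ℓ ^ n) = 1 := by
  have h := adeleAddCharAt_eq_one_of_mem K v hr
  rw [← Nat.cast_pow, adeleAddCharAt_natCast_mul] at h
  rw [← Circle.coe_pow, h, Circle.coe_one]

/-! ## §2. The twist formula -/

/-- The image of `ℤ_ℓ` under the canonical `ℚ_ℓ → K_v` lies in `𝒪_v` (tree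
`LocalField.valuation_padicRingHom_le_one`, in the `Valued.v` currency); Serre, *Local Fields* Ch. II §5 (`ℤ_ℓ ⊂ 𝒪_K`). [cite: SerreLocalFields1979, Ch. II §5] -/
theorem algebraMap_padicInt_mem_adicCompletionIntegers {ℓ : ℕ} [Fact ℓ.Prime]
    (hv : ((ℓ : ℕ) : 𝓞 K) ∈ v.asIdeal) (z : ℤ_[ℓ]) :
    letI := LocalField.adicCompletionPadicAlgebra v ℓ hv
    algebraMap ℚ_[ℓ] (v.adicCompletion K) (z : ℚ_[ℓ]) ∈ v.adicCompletionIntegers K := by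
  letI := LocalField.adicCompletionPadicAlgebra v ℓ hv
  haveI := LocalField.charZero_adicCompletion v
  rw [HeightOneSpectrum.mem_adicCompletionIntegers]
  have h : ValuativeRel.valuation (v.adicCompletion K)
      (algebraMap ℚ_[ℓ] (v.adicCompletion K) (z : ℚ_[ℓ])) ≤ 1 :=
    LocalField.valuation_padicRingHom_le_one (v.adicCompletion K) ℓ
      (LocalField.valuation_adicCompletion_natCast_lt_one v ℓ hv) z
  exact (Valued.v (R := v.adicCompletion K)).vle_one_iff.mp
    ((ValuativeRel.valuation (v.adicCompletion K)).vle_one_iff.mpr h)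

/-- **The Galois twist of the local additive character: `σ(ψ_v(r)) = ψ_v(χ_ℓ(σ) · r)`** for every ring
automorphism `σ` of `ℂ`, every finite place `v ∣ ℓ` and every `r ∈ K_v`, where `χ_ℓ(σ) ∈ ℤ_ℓ^×` is the
`ℓ`-adic cyclotomic character of `σ` (Mathlib `cyclotomicCharacter ℂ ℓ σ`), read in `K_v` through the canonical
`ℚ_ℓ`-algebra structure `LocalField.adicCompletionPadicAlgebra v ℓ hv`.  Proof: `ψ_v(r)` is an `ℓⁿ`-th root of
unity for `ℓⁿ r ∈ 𝒪_v`, `σ` acts on `μ_{ℓⁿ}` by `a ≡ χ_ℓ(σ) (mod ℓⁿ)` (`cyclotomicCharacter.spec`), and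
`ψ_v(χ_ℓ(σ) r) = ψ_v(a r) ψ_v(z ℓⁿ r) = ψ_v(r)^a` with `χ_ℓ(σ) = a + z ℓⁿ`, `z ℓⁿ r ∈ 𝒪_v`.
[cite: Tate1950, §2.2] [cite: NeukirchSchmidtWingberg2008, (7.3.6)–(7.3.7)] -/
theorem ringEquiv_adeleAddCharAt_eq_cyclotomicCharacter_mul {ℓ : ℕ} [Fact ℓ.Prime]
    (hv : ((ℓ : ℕ) : 𝓞 K) ∈ v.asIdeal) (σ : ℂ ≃+* ℂ) (r : v.adicCompletion K) :
    letI := LocalField.adicCompletionPadicAlgebra v ℓ hv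
    σ (adeleAddCharAt K v r : ℂ) =
      adeleAddCharAt K v
        (algebraMap ℚ_[ℓ] (v.adicCompletion K) (((cyclotomicCharacter ℂ ℓ σ : ℤ_[ℓ]ˣ) : ℤ_[ℓ]) : ℚ_[ℓ]) * r) := by
  letI := LocalField.adicCompletionPadicAlgebra v ℓ hv
  haveI := LocalField.charZero_adicCompletion v
  haveI : Fact (1 < ℓ) := ⟨(Fact.out : ℓ.Prime).one_lt⟩
  -- `ℓⁿ r ∈ 𝒪_v`
  obtain ⟨n, hn⟩ := exists_pow_natCast_mul_mem_adicCompletionIntegers K v hv r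
  -- notation
  set χ : ℤ_[ℓ] := ((cyclotomicCharacter ℂ ℓ σ : ℤ_[ℓ]ˣ) : ℤ_[ℓ]) with hχ
  set a : ℕ := ((PadicInt.toZModPow n) χ).val with ha
  -- (1) `σ (ψ_v r) = ψ_v(r)^a`
  have h1 : σ (adeleAddCharAt K v r : ℂ) = (adeleAddCharAt K v r : ℂ) ^ a :=
    cyclotomicCharacter.spec ℓ σ (adeleAddCharAt K v r : ℂ) (adeleAddCharAt_pow_prime_pow_eq_one K v hn)
  -- (2) `χ - a ∈ (ℓⁿ)`: `χ = a + z ℓⁿ`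
  have h2 : χ - (a : ℤ_[ℓ]) ∈ Ideal.span {(ℓ : ℤ_[ℓ]) ^ n} := by
    rw [← PadicInt.ker_toZModPow, RingHom.mem_ker, map_sub, map_natCast, ha, ZMod.natCast_zmod_val,
      sub_self]
  obtain ⟨z, hz⟩ := Ideal.mem_span_singleton'.mp h2
  have hχa : χ = (a : ℤ_[ℓ]) + z * (ℓ : ℤ_[ℓ]) ^ n := by rw [hz, add_sub_cancel]
  -- (3) `χ·r = a·r + z·(ℓⁿ r)` in `K_v`, with `z·(ℓⁿ r) ∈ 𝒪_v`
  have h3 : algebraMap ℚ_[ℓ] (v.adicCompletion K) (χ : ℚ_[ℓ]) * r =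
      (a : v.adicCompletion K) * r +
        algebraMap ℚ_[ℓ] (v.adicCompletion K) (z : ℚ_[ℓ]) * ((ℓ : v.adicCompletion K) ^ n * r) := by
    rw [hχa, PadicInt.coe_add, PadicInt.coe_mul, PadicInt.coe_pow, PadicInt.coe_natCast, PadicInt.coe_natCast,
      map_add, map_mul, map_pow, map_natCast, map_natCast]
    ring
  have hw : algebraMap ℚ_[ℓ] (v.adicCompletion K) (z : ℚ_[ℓ]) * ((ℓ : v.adicCompletion K) ^ n * r) ∈
      v.adicCompletionIntegers K :=
    mul_mem (algebraMap_padicInt_mem_adicCompletionIntegers K v hv z) hn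
  -- (4) `ψ_v(χ r) = ψ_v(a r) · ψ_v(w) = ψ_v(r)^a`
  rw [h1, h3, AddChar.map_add_eq_mul, adeleAddCharAt_eq_one_of_mem K v hw, mul_one,
    adeleAddCharAt_natCast_mul, Circle.coe_pow]

/-- **Packaged form: `∃ κ ∈ 𝒪_v^×, σ ∘ ψ_v = ψ_v(κ ·)`** — for every ring automorphism `σ` of `ℂ` and every
finite place `v` (of residue characteristic `ℓ`) there is `κ ∈ K_v` with `|κ|_v = 1` and `σ(ψ_v(r)) = ψ_v(κ r)`
for all `r ∈ K_v` (namely `κ = χ_ℓ(σ)`, `ringEquiv_adeleAddCharAt_eq_cyclotomicCharacter_mul`; a unit of `ℤ_ℓ`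
maps to a unit of `𝒪_v`). [cite: Tate1950, §2.2] [cite: NeukirchSchmidtWingberg2008, (7.3.6)–(7.3.7)] -/
theorem exists_ringEquiv_adeleAddCharAt_eq_mul {ℓ : ℕ} [Fact ℓ.Prime]
    (hv : ((ℓ : ℕ) : 𝓞 K) ∈ v.asIdeal) (σ : ℂ ≃+* ℂ) :
    ∃ κ : v.adicCompletion K, Valued.v κ = 1 ∧
      ∀ r : v.adicCompletion K, σ (adeleAddCharAt K v r : ℂ) = adeleAddCharAt K v (κ * r) := by
  letI := LocalField.adicCompletionPadicAlgebra v ℓ hv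
  haveI := LocalField.charZero_adicCompletion v
  set u : ℤ_[ℓ]ˣ := cyclotomicCharacter ℂ ℓ σ with hu
  refine ⟨algebraMap ℚ_[ℓ] (v.adicCompletion K) ((u : ℤ_[ℓ]) : ℚ_[ℓ]), ?_,
    fun r => ringEquiv_adeleAddCharAt_eq_cyclotomicCharacter_mul K v hv σ r⟩
  -- `|χ_ℓ(σ)|_v = 1`: both `χ_ℓ(σ)` and its inverse are in `𝒪_v`
  have h1 : Valued.v (algebraMap ℚ_[ℓ] (v.adicCompletion K) ((u : ℤ_[ℓ]) : ℚ_[ℓ])) ≤ 1 :=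
    (HeightOneSpectrum.mem_adicCompletionIntegers (𝓞 K) K v).mp
      (algebraMap_padicInt_mem_adicCompletionIntegers K v hv (u : ℤ_[ℓ]))
  have h2 : Valued.v (algebraMap ℚ_[ℓ] (v.adicCompletion K) ((u⁻¹ : ℤ_[ℓ]ˣ) : ℤ_[ℓ])) ≤ 1 :=
    (HeightOneSpectrum.mem_adicCompletionIntegers (𝓞 K) K v).mp
      (algebraMap_padicInt_mem_adicCompletionIntegers K v hv ((u⁻¹ : ℤ_[ℓ]ˣ) : ℤ_[ℓ]))
  have hprod : algebraMap ℚ_[ℓ] (v.adicCompletion K) ((u : ℤ_[ℓ]) : ℚ_[ℓ]) *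
      algebraMap ℚ_[ℓ] (v.adicCompletion K) (((u⁻¹ : ℤ_[ℓ]ˣ) : ℤ_[ℓ]) : ℚ_[ℓ]) = 1 := by
    rw [← map_mul, ← PadicInt.coe_mul, Units.mul_inv, PadicInt.coe_one, map_one]
  have hv1 : Valued.v (algebraMap ℚ_[ℓ] (v.adicCompletion K) ((u : ℤ_[ℓ]) : ℚ_[ℓ])) *
      Valued.v (algebraMap ℚ_[ℓ] (v.adicCompletion K) (((u⁻¹ : ℤ_[ℓ]ˣ) : ℤ_[ℓ]) : ℚ_[ℓ])) = 1 := by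
    rw [← map_mul, hprod, map_one]
  exact le_antisymm h1 (by
    calc (1 : WithZero (Multiplicative ℤ))
        = Valued.v (algebraMap ℚ_[ℓ] (v.adicCompletion K) ((u : ℤ_[ℓ]) : ℚ_[ℓ])) *
            Valued.v (algebraMap ℚ_[ℓ] (v.adicCompletion K) (((u⁻¹ : ℤ_[ℓ]ˣ) : ℤ_[ℓ]) : ℚ_[ℓ])) := hv1.symm
      _ ≤ Valued.v (algebraMap ℚ_[ℓ] (v.adicCompletion K) ((u : ℤ_[ℓ]) : ℚ_[ℓ])) * 1 := by gcongr
      _ = _ := mul_one _)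

/-- **`σ ∘ ψ_v = ψ_v.mulShift κ`** — the same in Mathlib's `AddChar.mulShift` currency (the hypothesis shape
`hσψ : ∀ x, σ (ψ x) = ψ' x` of the Schrödinger-model twist, with `ψ' := ψ_v.mulShift κ`, `|κ|_v = 1`).
[cite: Tate1950, §2.2] [cite: NeukirchSchmidtWingberg2008, (7.3.6)–(7.3.7)] -/
theorem exists_ringEquiv_adeleAddCharAt_eq_mulShift {ℓ : ℕ} [Fact ℓ.Prime]
    (hv : ((ℓ : ℕ) : 𝓞 K) ∈ v.asIdeal) (σ : ℂ ≃+* ℂ) :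
    ∃ κ : v.adicCompletion K, Valued.v κ = 1 ∧
      ∀ r : v.adicCompletion K,
        σ (adeleAddCharAt K v r : ℂ) = ((adeleAddCharAt K v).mulShift κ r : ℂ) := by
  obtain ⟨κ, hκ, h⟩ := exists_ringEquiv_adeleAddCharAt_eq_mul K v hv σ
  exact ⟨κ, hκ, fun r => by rw [h r, AddChar.mulShift_apply]⟩

/-- **Consumer package in the `(τ, τ′) = (σ, σ⁻¹)` ring-homomorphism currency** of the Schrödinger-model
Galois twist (`HeisenbergGroup/SchrodingerGaloisTwist`: binders `τ τ' : ℂ →+* ℂ`, `hττ'`, `hτ'τ`,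
`hτ : ∀ r, τ (ψ r) = ψ' r`): for `σ : ℂ ≃+* ℂ` and `v ∣ ℓ` there is `κ ∈ K_v` with `|κ|_v = 1` such that
`τ := σ`, `τ′ := σ⁻¹` are mutually inverse and `τ(ψ_v(r)) = ψ_v(κ r)` for all `r` — feed with
`ψ' := ψ_v.mulShift κ`. [cite: Tate1950, §2.2] [cite: NeukirchSchmidtWingberg2008, (7.3.6)–(7.3.7)] -/
theorem exists_ringHom_adeleAddCharAt_eq_mul {ℓ : ℕ} [Fact ℓ.Prime]
    (hv : ((ℓ : ℕ) : 𝓞 K) ∈ v.asIdeal) (σ : ℂ ≃+* ℂ) :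
    ∃ κ : v.adicCompletion K, Valued.v κ = 1 ∧
      (∀ z : ℂ, (σ : ℂ →+* ℂ) ((σ.symm : ℂ →+* ℂ) z) = z) ∧
      (∀ z : ℂ, (σ.symm : ℂ →+* ℂ) ((σ : ℂ →+* ℂ) z) = z) ∧
      ∀ r : v.adicCompletion K,
        (σ : ℂ →+* ℂ) (adeleAddCharAt K v r : ℂ) = adeleAddCharAt K v (κ * r) := by
  obtain ⟨κ, hκ, h⟩ := exists_ringEquiv_adeleAddCharAt_eq_mul K v hv σ
  exact ⟨κ, hκ, fun z => σ.apply_symm_apply z, fun z => σ.symm_apply_apply z, fun r => h r⟩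

end Literature.NumberTheory.Automorphic

end
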